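import Summits.NavierStokesRegularity.NavierStokesRegularity.Theorems.TypeICertificateLadderTargetDepletionAlignmentIdentity
import HarnessLib

/-!
# Crux `Target` = `TypeICertificateLadder.NoTypeIBlowup` (stmt-NavierStokesRegularity-1217), line
# `depletion-ladder`, stub S1: the LOCALIZED alignment identity and the local concentration law `R² + Q_φ ≤ 1`

`--supports stmt-NavierStokesRegularity-1217` (fourth file of the seat's "structure of
near-extremisers" series: `…TargetDepletionLambPairing`, `…AlignmentDefect`, `…AlignmentIdentity`).

The chain `Q ≤ A ≤ 1 − R²` of `…TargetDepletionAlignmentIdentity.lean` bounds the aligned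
palinstrophy fraction `A` from below by the spectral concentration `Q = ‖ω‖₂⁴/(‖u‖₂²‖∇ω‖₂²)`, which
contains the GLOBAL energy — supercritical, hence useless along a Type-I flow (`Q(t) → 0` at a
singular time). This file localizes the identity behind it: for any compactly supported `C¹`
weight `φ`,

* `integral_mul_inner_curl_curl_eq` — `∫ φ⟪u, curl ω⟫ = ∫ φ‖ω‖² − ∫⟪u, ∇φ × ω⟫` (the flux term is
  written with the tree's `curlCLM ((Dφ) ⊗ ω) = ∇φ × ω`; tree `integral_mul_inner_curl_eq`), on the
  definition's class WITHOUT any decay of `u`;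
* `sq_integral_mul_inner_curl_curl_le` — Cauchy–Schwarz with the LOCAL energy
  `E_φ = ∫ φ²‖u‖²`: `(∫ φ⟪u, curl ω⟫)² ≤ E_φ · ∫⟪u, curl ω⟫²/‖u‖²`;
* `sq_integral_stretching_add_localConcentration_le` — with the direction-defect law
  (`sq_integral_stretching_le_direction_defect`) and `‖curl ω‖₂ = ‖∇ω‖₂` (`u ∈ C³`):
  `(∫⟪ω, Du ω⟫)² + M²‖ω‖₂² (∫φ⟪u, curl ω⟫)²/E_φ ≤ M²‖ω‖₂²‖∇ω‖₂²`, i.e. `R² + Q_φ ≤ 1` with the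
  LOCAL concentration `Q_φ := (Z_φ − Φ_φ)²/(E_φ ‖∇ω‖₂²)`, `Z_φ = ∫φ‖ω‖²` the enstrophy seen by `φ`,
  `Φ_φ = ∫⟪u, ∇φ × ω⟫` the flux through the cut-off.

Why this is the right currency for the crux: along a Type-I flow (`|u| ≤ C√(ν/(T−t))`) take `φ` a
cut-off at the parabolic scale `ℓ = λ√(ν(T−t))` around the vorticity; then
`E_φ ≤ C²ν(T−t)⁻¹·|supp φ| ~ C²λ³ν^{5/2}(T−t)^{1/2}` and, in the Grönwall-critical regime
`‖∇ω‖₂² ≈ C²‖ω‖₂²/(4ν(T−t))`, `Q_φ ≈ 4(Z_φ−Φ_φ)²(T−t)^{1/2}/(λ³C⁴ν^{3/2}‖ω‖₂²)·‖ω‖₂²/‖ω‖₂²` is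
SCALE-INVARIANT and bounded below by `(Z_φ/‖ω‖₂²)² × const(λ, C)` times the Leray lower bound
`‖ω‖₂²√(T−t) ≥ cν^{3/2}`: a lower bound on `A(t)`, hence flow-wise depletion
(`rung_of_eventualDepletion`), would follow from ENSTROPHY CONFINEMENT AT THE PARABOLIC SCALE
(`Z_φ ≥ (1−ε)‖ω‖₂²`, flux `Φ_φ` small) — the typed "What is missing" of the seat's census. No such
confinement is proved here or in print with constants (Barker–Prange 2020 Thm 2 concentrates `L³`,
non-quantitatively).

WHAT THIS IS NOT: not a depletion constant, not a rung; identities and Cauchy–Schwarz. [folklore]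
-/

noncomputable section

open Set Function Filter Topology MeasureTheory
open scoped RealInnerProductSpace ENNReal NNReal ContDiff
open Literature.Analysis.FluidPDE

namespace Summit.NavierStokesRegularity.NavierStokesRegularity.Theorems.DepletionLadder

-- the problem directory repeats the summit name (`NavierStokesRegularity/NavierStokesRegularity`)
set_option linter.dupNamespace false

section Class

variable {u : EuclideanSpace ℝ (Fin 3) → EuclideanSpace ℝ (Fin 3)} {M : ℝ}
  {φ : EuclideanSpace ℝ (Fin 3) → ℝ}

/-- **The localized alignment identity.** For `u ∈ C²(ℝ³; ℝ³)` (no decay) and a compactly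
supported `C¹` weight `φ`: `∫ φ⟪u, curl curl u⟫ = ∫ φ‖curl u‖² − ∫⟪u, curlCLM (Dφ ⊗ curl u)⟫`
(`curlCLM ((Dφ x).smulRight w) = ∇φ(x) × w`; tree `integral_mul_inner_curl_eq` with `F = u`,
`W = curl u`). The enstrophy seen by `φ` is paid by local velocity–palinstrophy alignment up to a
flux through `supp ∇φ`. [folklore] -/
theorem integral_mul_inner_curl_curl_eq (hu : ContDiff ℝ 2 u) (hφ : ContDiff ℝ 1 φ)
    (hcφ : HasCompactSupport φ) :
    ∫ x, φ x * ⟪u x, curl (curl u) x⟫ =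
      (∫ x, φ x * ‖curl u x‖ ^ 2) -
        ∫ x, ⟪u x, curlCLM ((fderiv ℝ φ x).smulRight (curl u x))⟫ := by
  have hu1 : ContDiff ℝ 1 u := hu.of_le (by norm_num)
  have hω1 : ContDiff ℝ 1 (curl u) := contDiff_one_curl_of_contDiff_two hu
  have h := integral_mul_inner_curl_eq hu1 hω1 hφ hcφ
  have h' : ∫ x, φ x * ⟪curl u x, curl u x⟫ = ∫ x, φ x * ‖curl u x‖ ^ 2 :=
    integral_congr_ae (Eventually.of_forall fun x => by
      show φ x * ⟪curl u x, curl u x⟫ = φ x * ‖curl u x‖ ^ 2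
      rw [real_inner_self_eq_norm_sq])
  rw [h'] at h
  linarith

/-- **The flux bound.** `|∫⟪u, ∇φ × curl u⟫| ≤ ‖curlCLM‖ · M · L · ∫_{tsupport φ} ‖curl u‖` when
`|u| ≤ M` and `‖Dφ‖ ≤ L`. [folklore] -/
theorem abs_integral_inner_curlCLM_smulRight_le (hu : ContDiff ℝ 2 u) (hM : ∀ x, ‖u x‖ ≤ M)
    (hcφ : HasCompactSupport φ) {L : ℝ} (hL : ∀ x, ‖fderiv ℝ φ x‖ ≤ L) :
    |∫ x, ⟪u x, curlCLM ((fderiv ℝ φ x).smulRight (curl u x))⟫| ≤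
      ‖curlCLM‖ * M * L * ∫ x in tsupport φ, ‖curl u x‖ := by
  have hM0 : 0 ≤ M := (norm_nonneg _).trans (hM 0)
  have hL0 : 0 ≤ L := (norm_nonneg _).trans (hL 0)
  have cω : Continuous (curl u) := continuous_curl (hu.of_le (by norm_num))
  -- the integrand vanishes off `tsupport φ`
  set g : EuclideanSpace ℝ (Fin 3) → ℝ :=
    fun x => ⟪u x, curlCLM ((fderiv ℝ φ x).smulRight (curl u x))⟫ with hg
  have hsupp : support g ⊆ tsupport φ := by
    intro x hx
    by_contra hxs
    have hD : fderiv ℝ φ x = 0 := fderiv_of_notMem_tsupport ℝ hxs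
    exact hx (by simp [hg, hD])
  have hbd : ∀ x, |g x| ≤ ‖curlCLM‖ * M * L * ‖curl u x‖ := fun x => by
    calc |g x| ≤ ‖u x‖ * ‖curlCLM ((fderiv ℝ φ x).smulRight (curl u x))‖ := abs_real_inner_le_norm _ _
      _ ≤ M * (‖curlCLM‖ * (L * ‖curl u x‖)) := by
          refine mul_le_mul (hM x) ((norm_curlCLM_smulRight_le _ _).trans ?_) (norm_nonneg _) hM0
          exact mul_le_mul_of_nonneg_left (mul_le_mul_of_nonneg_right (hL x) (norm_nonneg _))
            (norm_nonneg curlCLM)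
      _ = ‖curlCLM‖ * M * L * ‖curl u x‖ := by ring
  have hK : IsCompact (tsupport φ) := hcφ
  have iω : IntegrableOn (fun x => ‖curlCLM‖ * M * L * ‖curl u x‖) (tsupport φ) volume :=
    (cω.norm.continuousOn.integrableOn_compact hK).const_mul _
  set m : EuclideanSpace ℝ (Fin 3) → ℝ :=
    (tsupport φ).indicator fun x => ‖curlCLM‖ * M * L * ‖curl u x‖ with hm
  have im : Integrable m := iω.integrable_indicator hK.measurableSet
  have hgm : ∀ x, ‖g x‖ ≤ m x := by
    intro x
    rw [Real.norm_eq_abs, hm]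
    by_cases hx : x ∈ tsupport φ
    · rw [indicator_of_mem hx]; exact hbd x
    · rw [indicator_of_notMem hx]
      have : g x = 0 := notMem_support.1 fun h => hx (hsupp h)
      rw [this, abs_zero]
  have h := norm_integral_le_of_norm_le im (Eventually.of_forall hgm)
  rw [Real.norm_eq_abs, hm, integral_indicator hK.measurableSet, integral_const_mul] at h
  exact h

/-- **Cauchy–Schwarz with the LOCAL energy.** For `u ∈ C²` bounded by `M` with
`|∇ curl u|_F ∈ L²` and a compactly supported `C¹` weight `φ`:
`(∫ φ⟪u, curl ω⟫)² ≤ (∫ φ²‖u‖²) · ∫ ⟪u, curl ω⟫²/‖u‖²` (`φ⟪u,c⟫ = (φ‖u‖)·(⟪u,c⟫/‖u‖)`). Only the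
energy INSIDE the support of `φ` enters. [folklore] -/
theorem sq_integral_mul_inner_curl_curl_le (hu : ContDiff ℝ 2 u) (hM : ∀ x, ‖u x‖ ≤ M)
    (iA : Integrable (fun x => frobeniusNormSq (fderiv ℝ (curl u) x)))
    (hφ : ContDiff ℝ 1 φ) (hcφ : HasCompactSupport φ) :
    (∫ x, φ x * ⟪u x, curl (curl u) x⟫) ^ 2 ≤
      (∫ x, φ x ^ 2 * ‖u x‖ ^ 2) * ∫ x, ⟪u x, curl (curl u) x⟫ ^ 2 / ‖u x‖ ^ 2 := by
  have cc : Continuous (curl (curl u)) := continuous_curl (contDiff_one_curl_of_contDiff_two hu)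
  set g : EuclideanSpace ℝ (Fin 3) → ℝ := fun x => ⟪u x, curl (curl u) x⟫ / ‖u x‖ with hg
  have hpt : ∀ x, φ x * ⟪u x, curl (curl u) x⟫ = (φ x * ‖u x‖) * g x := fun x => by
    rcases eq_or_ne (u x) 0 with h0 | h0
    · simp [h0]
    · simp only [hg]
      rw [mul_assoc, mul_div_cancel₀ _ (norm_ne_zero_iff.2 h0)]
  have hg2 : ∀ x, g x ^ 2 = ⟪u x, curl (curl u) x⟫ ^ 2 / ‖u x‖ ^ 2 := fun x => by
    simp only [hg, div_pow]
  have hgle : ∀ x, g x ^ 2 ≤ ‖curl (curl u) x‖ ^ 2 := fun x =>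
    (hg2 x).symm ▸ (inner_cross_sq_le_direction (a := curl u x) (c := curl (curl u) x) (hM x)).1
  have meas_g : Measurable g :=
    (hu.continuous.inner cc).measurable.div hu.continuous.norm.measurable
  have ig2 : Integrable (fun x => g x ^ 2) :=
    (integrable_norm_curl_curl_sq hu iA).mono' (meas_g.pow_const 2).aestronglyMeasurable
      (Eventually.of_forall fun x => by
        rw [Real.norm_of_nonneg (sq_nonneg _)]; exact hgle x)
  have mg : MemLp (fun x => |g x|) 2 volume := by
    refine (memLp_two_iff_integrable_sq (meas_g.aestronglyMeasurable.norm)).2 ?_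
    refine ig2.congr (Eventually.of_forall fun x => ?_)
    show g x ^ 2 = |g x| ^ 2
    rw [sq_abs]
  -- the local energy density `φ‖u‖` is continuous with compact support
  have cf : Continuous fun x => φ x * ‖u x‖ := hφ.continuous.mul hu.continuous.norm
  have hcf : HasCompactSupport fun x => φ x * ‖u x‖ := hcφ.mul_right
  have mf : MemLp (fun x => |φ x * ‖u x‖|) 2 volume :=
    (cf.abs.memLp_of_hasCompactSupport (hcf.norm.mono fun x hx => by simpa using hx))
  have h1 : |∫ x, φ x * ⟪u x, curl (curl u) x⟫| ≤ ∫ x, |φ x * ‖u x‖| * |g x| := by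
    refine abs_integral_le_integral_abs.trans (le_of_eq (integral_congr_ae
      (Eventually.of_forall fun x => ?_)))
    show |φ x * ⟪u x, curl (curl u) x⟫| = |φ x * ‖u x‖| * |g x|
    rw [hpt x, abs_mul]
  have h2 : ∫ x, |φ x * ‖u x‖| * |g x| ≤
      Real.sqrt (∫ x, |φ x * ‖u x‖| ^ 2) * Real.sqrt (∫ x, |g x| ^ 2) :=
    integral_mul_le_sqrt_mul_sqrt_of_memLp mf mg
  have h3 : ∫ x, |g x| ^ 2 = ∫ x, ⟪u x, curl (curl u) x⟫ ^ 2 / ‖u x‖ ^ 2 :=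
    integral_congr_ae (Eventually.of_forall fun x => by
      show |g x| ^ 2 = ⟪u x, curl (curl u) x⟫ ^ 2 / ‖u x‖ ^ 2
      rw [sq_abs, hg2 x])
  have h4 : ∫ x, |φ x * ‖u x‖| ^ 2 = ∫ x, φ x ^ 2 * ‖u x‖ ^ 2 :=
    integral_congr_ae (Eventually.of_forall fun x => by
      show |φ x * ‖u x‖| ^ 2 = φ x ^ 2 * ‖u x‖ ^ 2
      rw [sq_abs, mul_pow])
  rw [h3, h4] at h2
  have hE0 : 0 ≤ ∫ x, φ x ^ 2 * ‖u x‖ ^ 2 := integral_nonneg fun x => by positivity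
  have hG0 : 0 ≤ ∫ x, ⟪u x, curl (curl u) x⟫ ^ 2 / ‖u x‖ ^ 2 :=
    integral_nonneg fun x => by positivity
  calc (∫ x, φ x * ⟪u x, curl (curl u) x⟫) ^ 2
      = |∫ x, φ x * ⟪u x, curl (curl u) x⟫| ^ 2 := (sq_abs _).symm
    _ ≤ (Real.sqrt (∫ x, φ x ^ 2 * ‖u x‖ ^ 2) *
          Real.sqrt (∫ x, ⟪u x, curl (curl u) x⟫ ^ 2 / ‖u x‖ ^ 2)) ^ 2 :=
        pow_le_pow_left₀ (abs_nonneg _) (h1.trans h2) 2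
    _ = (∫ x, φ x ^ 2 * ‖u x‖ ^ 2) * ∫ x, ⟪u x, curl (curl u) x⟫ ^ 2 / ‖u x‖ ^ 2 := by
        rw [mul_pow, Real.sq_sqrt hE0, Real.sq_sqrt hG0]

/-- **The local concentration law `R² + Q_φ ≤ 1`.** For `u ∈ C³(ℝ³; ℝ³)` divergence-free, bounded
by `M`, with `ω = curl u ∈ L²`, `|∇ω|_F ∈ L²`, integrable stretching density (the class of
`StretchingDepletion`; NO global energy), and any compactly supported `C¹` weight `φ`:
`(∫⟪ω, Du ω⟫)² + M²‖ω‖₂² · (∫φ⟪u, curl ω⟫)²/∫φ²‖u‖² ≤ M²‖ω‖₂²‖∇ω‖₂²` (`x/0 = 0`), where by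
`integral_mul_inner_curl_curl_eq` the numerator is `(∫φ‖ω‖² − ∫⟪u, ∇φ × ω⟫)²`: the enstrophy
captured by `φ`, net of the flux through the cut-off, measured against the LOCAL energy, is
Cauchy–Schwarz slack. [folklore] -/
theorem sq_integral_stretching_add_localConcentration_le (hu : ContDiff ℝ 3 u)
    (hdiv : VectorCalculus.IsDivFree u) (hM : ∀ x, ‖u x‖ ≤ M)
    (iZ : Integrable (fun x => ‖curl u x‖ ^ 2))
    (iA : Integrable (fun x => frobeniusNormSq (fderiv ℝ (curl u) x)))
    (iJ : Integrable (fun x => ⟪curl u x, fderiv ℝ u x (curl u x)⟫))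
    (hφ : ContDiff ℝ 1 φ) (hcφ : HasCompactSupport φ) :
    (∫ x, ⟪curl u x, fderiv ℝ u x (curl u x)⟫) ^ 2 +
        M ^ 2 * (∫ x, ‖curl u x‖ ^ 2) *
          ((∫ x, φ x * ⟪u x, curl (curl u) x⟫) ^ 2 / ∫ x, φ x ^ 2 * ‖u x‖ ^ 2) ≤
      M ^ 2 * (∫ x, ‖curl u x‖ ^ 2) * ∫ x, frobeniusNormSq (fderiv ℝ (curl u) x) := by
  have hu2 : ContDiff ℝ 2 u := hu.of_le (by norm_num)
  have h := sq_integral_stretching_le_direction_defect hu2 hdiv hM iZ iA iJ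
  rw [integral_norm_curl_curl_sq_eq hu iZ iA] at h
  have hCS := sq_integral_mul_inner_curl_curl_le hu2 hM iA hφ hcφ
  have hMZ0 : 0 ≤ M ^ 2 * ∫ x, ‖curl u x‖ ^ 2 :=
    mul_nonneg (sq_nonneg _) (integral_nonneg fun x => sq_nonneg _)
  have hG0 : 0 ≤ ∫ x, ⟪u x, curl (curl u) x⟫ ^ 2 / ‖u x‖ ^ 2 :=
    integral_nonneg fun x => by positivity
  rcases eq_or_lt_of_le (integral_nonneg (fun x => by positivity) :
      (0 : ℝ) ≤ ∫ x, φ x ^ 2 * ‖u x‖ ^ 2) with hE0 | hEpos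
  · rw [← hE0, div_zero, mul_zero, add_zero]
    nlinarith [mul_nonneg hMZ0 hG0]
  · have hQ : (∫ x, φ x * ⟪u x, curl (curl u) x⟫) ^ 2 / ∫ x, φ x ^ 2 * ‖u x‖ ^ 2 ≤
        ∫ x, ⟪u x, curl (curl u) x⟫ ^ 2 / ‖u x‖ ^ 2 := by
      rw [div_le_iff₀ hEpos, mul_comm]
      exact hCS
    nlinarith [mul_le_mul_of_nonneg_left hQ hMZ0]

end Class

end Summit.NavierStokesRegularity.NavierStokesRegularity.Theorems.DepletionLadder

end
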